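import Summits.BirchSwinnertonDyer.BirchSwinnertonDyer.Theorems.UniversalToricDescentTwinChoiceByName
import Summits.BirchSwinnertonDyer.BirchSwinnertonDyer.Theorems.UniversalToricDescentHessianTwinAtThree
import HarnessLib

/-!
# Route `UniversalToricDescent`, crux #3 bucket C (item stmt-BirchSwinnertonDyer-20695): the kernel ON THE HESSIAN TYPE `(4, ≥ 7)` — the `a₃ = 0` half of bucket C alone gives `BSD₃` there, by name

Cell `bsd-wall` (W-ALL lane 3, row 2·3@3), seat `bsd-wall-utd-p2` g7 (LEAD, line mode on item 20695),
2026-08-27. `--supports stmt-BirchSwinnertonDyer-20695`. Pure logic over two landed files: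
`UniversalToricDescentTwinChoiceByName.lean` (p579334/p579882, seat g6: the pointwise kernel
`bsdp_three_of_twinIMCAtThreeAt` — crux #3 is consumed ONCE, at the twin handed over, `K` chosen after) and
`UniversalToricDescentHessianTwinAtThree.lean` (this seat: on the `3`-adic type `v₃(c₄) = 4`, `v₃(c₆) ≥ 7`
the HESSIAN `D(0:1)` is a globally-minimal-isable, `3`-congruent, good-supersingular, `a₃ = 0`, onto twin —
PROVED, no named fact).

WHAT IS PROVED.
* `bsdp_three_of_apZero_on_hessianType` — **on the Hessian type the kernel needs ONLY the `a₃ = 0` half of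
  bucket C**: published inputs `hF`, transport `hT`, Waldspurger frame `hV`, control `hC`, rank-zero twist
  `hZ`, and `hS0 : ∀ W′, GoodSS W′ 3 → a₃(W′) = 0 → ρ̄₃ onto → TwinIMCAtThreeAt W′` ⟹ `BSD₃(E)` for EVERY
  wild curve `E` of the attacked cell (`ClassO6`, `r_an = 1`, `ρ̄₃` onto) with `v₃(c₄) = 4`, `v₃(c₆) ≥ 7`.
  No twin hypothesis (the Hessian IS the twin), no bucket A / B input, no supply statement, no `d_K`.
* `cellSupply_on_hessianType` — g6's supply-on-the-cell hypothesis (`…ByName` §5) HOLDS on the type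
  (indeed without its `HasGoodSSTwinAtThree` antecedent).
* `bsdp_three_of_apZero_of_cellSupplyOffType` / `wAllExclAddWildRankOneSurjTwin_of_apZero_of_cellSupplyOffType`
  — g6's `bsdp_three_of_apZero_of_cellSupply` / leaf-by-name with the supply hypothesis now demanded ONLY
  OFF the Hessian type (wild curves of the cell with a good-supersingular twin but `¬(v₃c₄ = 4 ∧ v₃c₆ ≥ 7)`;
  census TWIN-PRINT-AT3-v1 / utd-idea g9 HESSIAN-TWIN-v1: `0` of `603` bucket-C classes are off the type).

READING (numbers, not adjectives). Bucket C of the twin census = `603` classes, all of type `(4, 7, 9)`: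
for every curve of that TYPE (not only the census rows) the W-ALL obligation at `3` is reduced BY NAME to
{published inputs, transport 20186, Waldspurger 20929-glue inputs, control, rank-zero twist} + the `a₃ = 0`
half `C₀` of crux #3-C — the ONE port-shaped statement (Castella–Wan Thm 5.12 + ± ERL at `p = 3`,
carriers refereed at `3` by Hatley–Lei–Vigni 2022; memo SUPSET-AT3-v9 §3). The `a₃ = ±3` half of item 20695,
the even-`d_K` child 20696 and the supply item of TURNKEY R2′ are NOT load-bearing on the type. What is NOT
proved: `C₀` itself (research), nor that every bucket-C curve beyond the census has the Hessian type.

HONEST FRAMING: conditional results (the kernel's named inputs and `C₀` are hypotheses BY NAME), pure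
logic; nothing closes; no statement item is filed (D-0014); BSD is not proved for any curve here;
beyond-print BSD theorem: NO. References: memos HOME/bsd-wall-utd-p2/SUPSET-AT3-v9.md,
HOME/bsd-wall-utd-idea/LENS-MEMO-UTD-IDEA-v11.md §5–§6; T. Fisher, Proc. LMS 104 (2012) Thm. 13.2
[Fisher2012Hessian].
-/

set_option autoImplicit false
set_option linter.dupNamespace false

noncomputable section

open scoped Classical

namespace Summit.BirchSwinnertonDyer.BirchSwinnertonDyer.Theorems.UniversalToricDescentHessianTwin

open WeierstrassCurve NumberField IsDedekindDomain Field
  Literature.NumberTheory.EllipticCurves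
  Literature.NumberTheory.EllipticCurves.ModularForms
  Literature.NumberTheory.EllipticCurves.Rank1Residual
  Summit.BirchSwinnertonDyer.Rank1Residual
  Summit.BirchSwinnertonDyer.Rank1Residual.X11b
  Summit.BirchSwinnertonDyer.Rank1Residual.X11b.AcSelmer
  Summit.BirchSwinnertonDyer.Rank1Residual.X11b.Halves
  Summit.BirchSwinnertonDyer.BirchSwinnertonDyer.Theses.UniversalToricDescent
  Summit.BirchSwinnertonDyer.BirchSwinnertonDyer.Theorems
  Summit.BirchSwinnertonDyer.BirchSwinnertonDyer.Theorems.UniversalToricDescentTwinChoice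

/-! ### §1. On the Hessian type the `a₃ = 0` half of bucket C alone gives `BSD₃` -/

/-- **Kernel on the Hessian type.** Published inputs, transport, Waldspurger frame, control, rank-zero
twist, and the `a₃ = 0` half of bucket C (`hS0`) ⟹ `BSD₃(E)` for every wild curve `E` of the attacked cell
(`Additive.ClassO6 E 3`, `r_an(E) = 1`, `ρ̄_{E,3}` onto) of `3`-adic type `v₃(c₄) = 4`, `v₃(c₆) ≥ 7`: the
handed twin is a global minimal model of the HESSIAN `D(0:1)` of `E` (good supersingular at `3`, `a₃ = 0`,
`3`-congruent, onto — `exists_goodSS_apZero_surj_twin_of_padicValRat`, PROVED), at which the pointwise kernel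
`bsdp_three_of_twinIMCAtThreeAt` consumes `hS0`. No twin hypothesis, no bucket A/B input, no supply.
[folklore] -/
theorem bsdp_three_of_apZero_on_hessianType (hF : ToricPublishedInputs) (hT : ToricTransportModThree)
    (hV : WildSplitWaldspurgerAtThree) (hC : WildSplitControlAtThree) (hZ : WildRankZeroTwistAtThree)
    (hS0 : ∀ (W' : WeierstrassCurve ℚ) [W'.IsElliptic] [W'.IsGloballyMinimal],
      GoodSS W' 3 → W'.frobeniusTrace 3 = 0 → W'.HasSurjectiveModNGaloisRep 3 → TwinIMCAtThreeAt W') :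
    ∀ (W : WeierstrassCurve ℚ) [W.IsElliptic] [W.IsGloballyMinimal], Additive.ClassO6 W 3 →
      W.analyticRank = 1 → W.HasSurjectiveModNGaloisRep 3 →
      padicValRat 3 W.c₄ = 4 → 7 ≤ padicValRat 3 W.c₆ → BSDp W 3 := by
  intro W _ _ hO6 hr hsurj h4 h7
  obtain ⟨W', hW'e, hW'm, hcong, hss, h0, hnadd, hW'surj⟩ :=
    exists_goodSS_apZero_surj_twin_of_padicValRat W h4 h7 hsurj
  exact bsdp_three_of_twinIMCAtThreeAt hF hT hV hC hZ W hO6 hr hsurj W' hcong hnadd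
    (hS0 W' hss h0 hW'surj)

/-- **The leaf's twin-cell slice on the Hessian type, from the `a₃ = 0` half alone** (same statement with
the leaf's — here idle — existential twin hypothesis displayed, for by-name matching with
`WAllExclAddWildRankOneSurjTwin` restricted to the type). [folklore] -/
theorem bsdp_three_of_apZero_on_hessianType_twinCell (hF : ToricPublishedInputs)
    (hT : ToricTransportModThree) (hV : WildSplitWaldspurgerAtThree) (hC : WildSplitControlAtThree)
    (hZ : WildRankZeroTwistAtThree)
    (hS0 : ∀ (W' : WeierstrassCurve ℚ) [W'.IsElliptic] [W'.IsGloballyMinimal],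
      GoodSS W' 3 → W'.frobeniusTrace 3 = 0 → W'.HasSurjectiveModNGaloisRep 3 → TwinIMCAtThreeAt W') :
    ∀ (W : WeierstrassCurve ℚ) [W.IsElliptic] [W.IsGloballyMinimal], ¬ W.HasCM → Additive.ClassO6 W 3 →
      W.analyticRank = 1 → W.HasSurjectiveModNGaloisRep 3 →
      (∃ (W' : WeierstrassCurve ℚ) (_ : W'.IsElliptic) (_ : W'.IsGloballyMinimal),
        O6.ModPCongruent W' W 3 ∧ ¬ Addv W' 3 ∧ W'.HasSurjectiveModNGaloisRep 3) →
      padicValRat 3 W.c₄ = 4 → 7 ≤ padicValRat 3 W.c₆ → BSDp W 3 :=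
  fun W _ _ _ hO6 hr hsurj _ h4 h7 ↦ bsdp_three_of_apZero_on_hessianType hF hT hV hC hZ hS0 W hO6 hr hsurj h4 h7

/-! ### §2. The supply on the cell HOLDS on the Hessian type; it is needed only off the type -/

/-- **g6's cell-supply hypothesis holds on the Hessian type** (its `HasGoodSSTwinAtThree` antecedent and
the cell binders are not even used: `hasGoodSSApZeroTwinAtThree_of_padicValRat`). [folklore] -/
theorem cellSupply_on_hessianType :
    ∀ (W : WeierstrassCurve ℚ) [W.IsElliptic] [W.IsGloballyMinimal], Additive.ClassO6 W 3 →
      W.analyticRank = 1 → W.HasSurjectiveModNGaloisRep 3 →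
      padicValRat 3 W.c₄ = 4 → 7 ≤ padicValRat 3 W.c₆ →
      HasGoodSSTwinAtThree W → HasGoodSSApZeroTwinAtThree W :=
  fun W _ _ _ _ _ h4 h7 _ ↦ hasGoodSSApZeroTwinAtThree_of_padicValRat W h4 h7

/-- **Kernel conclusion from the `a₃ = 0` half of bucket C and the supply OFF THE HESSIAN TYPE.** As
`UniversalToricDescentTwinChoice.bsdp_three_of_apZero_of_cellSupply` (g6), but the supply of an `a₃ = 0`
twin is demanded only for cell curves NOT of type `v₃(c₄) = 4 ∧ v₃(c₆) ≥ 7` (on the type the Hessian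
supplies it). Census: `0/603` bucket-C classes are off the type. [folklore] -/
theorem bsdp_three_of_apZero_of_cellSupplyOffType (hF : ToricPublishedInputs)
    (hT : ToricTransportModThree) (hP : TwinSplitIMCAtThreePrintedFacts)
    (hA : TwinSplitIMCAtThreeGoodOrdOfPrint) (hB : TwinSplitIMCAtThreeMult)
    (hS0 : ∀ (W' : WeierstrassCurve ℚ) [W'.IsElliptic] [W'.IsGloballyMinimal],
      GoodSS W' 3 → W'.frobeniusTrace 3 = 0 → W'.HasSurjectiveModNGaloisRep 3 → TwinIMCAtThreeAt W')
    (hsupplyOff : ∀ (W : WeierstrassCurve ℚ) [W.IsElliptic] [W.IsGloballyMinimal], Additive.ClassO6 W 3 →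
      W.analyticRank = 1 → W.HasSurjectiveModNGaloisRep 3 →
      ¬ (padicValRat 3 W.c₄ = 4 ∧ 7 ≤ padicValRat 3 W.c₆) →
      HasGoodSSTwinAtThree W → HasGoodSSApZeroTwinAtThree W)
    (hV : WildSplitWaldspurgerAtThree) (hC : WildSplitControlAtThree) (hZ : WildRankZeroTwistAtThree) :
    ∀ (W : WeierstrassCurve ℚ) [W.IsElliptic] [W.IsGloballyMinimal], Additive.ClassO6 W 3 →
      W.analyticRank = 1 → W.HasSurjectiveModNGaloisRep 3 →
      (∃ (W' : WeierstrassCurve ℚ) (_ : W'.IsElliptic) (_ : W'.IsGloballyMinimal),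
        O6.ModPCongruent W' W 3 ∧ ¬ Addv W' 3 ∧ W'.HasSurjectiveModNGaloisRep 3) → BSDp W 3 := by
  refine bsdp_three_of_apZero_of_cellSupply hF hT hP hA hB hS0 (fun W _ _ hO6 hr hsurj hss ↦ ?_) hV hC hZ
  by_cases htype : padicValRat 3 W.c₄ = 4 ∧ 7 ≤ padicValRat 3 W.c₆
  · exact hasGoodSSApZeroTwinAtThree_of_padicValRat W htype.1 htype.2
  · exact hsupplyOff W hO6 hr hsurj htype hss

/-- **The leaf BY NAME from the `a₃ = 0` half of bucket C and the supply OFF THE HESSIAN TYPE.** [folklore] -/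
theorem wAllExclAddWildRankOneSurjTwin_of_apZero_of_cellSupplyOffType (hF : ToricPublishedInputs)
    (hT : ToricTransportModThree) (hP : TwinSplitIMCAtThreePrintedFacts)
    (hA : TwinSplitIMCAtThreeGoodOrdOfPrint) (hB : TwinSplitIMCAtThreeMult)
    (hS0 : ∀ (W' : WeierstrassCurve ℚ) [W'.IsElliptic] [W'.IsGloballyMinimal],
      GoodSS W' 3 → W'.frobeniusTrace 3 = 0 → W'.HasSurjectiveModNGaloisRep 3 → TwinIMCAtThreeAt W')
    (hsupplyOff : ∀ (W : WeierstrassCurve ℚ) [W.IsElliptic] [W.IsGloballyMinimal], Additive.ClassO6 W 3 →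
      W.analyticRank = 1 → W.HasSurjectiveModNGaloisRep 3 →
      ¬ (padicValRat 3 W.c₄ = 4 ∧ 7 ≤ padicValRat 3 W.c₆) →
      HasGoodSSTwinAtThree W → HasGoodSSApZeroTwinAtThree W)
    (hV : WildSplitWaldspurgerAtThree) (hC : WildSplitControlAtThree) (hZ : WildRankZeroTwistAtThree) :
    Summit.BirchSwinnertonDyer.WAllExclAddWildRankOneSurjTwin :=
  Summit.BirchSwinnertonDyer.wAllExclAddWildRankOneSurjTwin_of_forall
    (bsdp_three_of_apZero_of_cellSupplyOffType hF hT hP hA hB hS0 hsupplyOff hV hC hZ)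

/-- **Item 20695 itself on the Hessian type**: granted bucket C's crux `TwinSplitIMCAtThreeGoodSS` by name
(item 20695, OPEN) instead of its `a₃ = 0` half, the same conclusion on the type (the crux implies its half:
`twinSplitIMCAtThreeGoodSS_iff_apZero_and_apNonzero`). Displayed so that the gate sees the crux decl consumed
by name on this line. [folklore] -/
theorem bsdp_three_of_twinSplitIMCAtThreeGoodSS_on_hessianType (hF : ToricPublishedInputs)
    (hT : ToricTransportModThree) (hV : WildSplitWaldspurgerAtThree) (hC : WildSplitControlAtThree)
    (hZ : WildRankZeroTwistAtThree) (hI : TwinSplitIMCAtThreeGoodSS) :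
    ∀ (W : WeierstrassCurve ℚ) [W.IsElliptic] [W.IsGloballyMinimal], Additive.ClassO6 W 3 →
      W.analyticRank = 1 → W.HasSurjectiveModNGaloisRep 3 →
      padicValRat 3 W.c₄ = 4 → 7 ≤ padicValRat 3 W.c₆ → BSDp W 3 :=
  bsdp_three_of_apZero_on_hessianType hF hT hV hC hZ (twinSplitIMCAtThreeGoodSS_iff_apZero_and_apNonzero.1 hI).1

end Summit.BirchSwinnertonDyer.BirchSwinnertonDyer.Theorems.UniversalToricDescentHessianTwin

end
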